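import Literature.MathematicalPhysics.QuantumFieldTheory.Balaban1983to89.B9Thm34AllFinal

/-!
# `Balaban1983to89.B9Thm34GpKernelFinal` — [Balaban1985BackgroundPropagators] THEOREM 3.4 p. 400, THE `G′(U′U)`-CLAUSE WITH ALL FOUR ENTRIES
# (3.42)₁₋₄ OF `G′(U′U)` IN THE PRINTED KERNEL FORM `|G′(U′U)(x,x′)| ≦ B(Lʲη)²(L^{j′}η)^{−d}e^{−(4δ₀/5)d(y,y′)}`,
# `|(∇G′(U′U))(x,x′)|, |(G′(U′U)∇*)(x,x′)| ≦ BLʲη(L^{j′}η)^{−d}e^{−(4δ₀/5)d}`, `|(∇G′(U′U)∇*)(x,x′)| ≦ B(L^{j′}η)^{−d}e^{−(4δ₀/5)d}` — FILE 29 of the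
# Sect. B programme of cell `lit-balaban`, seat r06 (B9 fold owner) gen 15: the `G′`-twin of FILE 25 (`B9Thm34GKernelFinal`, the `G`-clause in kernel form)

statement-level skeleton of published theorems with citation tags; proofs where landed; nothing here is a claim about the Yang–Mills mass gap

CITATION HEADER (lean-in-tree rule).  B9 = T. Bałaban, *Propagators for lattice gauge theories in a background field*, Commun. Math. Phys. **99** (1985)
389–434 [Balaban1985BackgroundPropagators] (held `paper:balaban1985-cmp99-background-propagators`, journal page = PDF page + 388; text layer re-read by
this seat 2026-08-22).  Theorem 3.4 p. 400 [PDF 12, L7–10] «There exists a positive constant a₁ such that the operators G′(U), (Q′(U)G′²(U)Q′*(U))⁻¹,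
R(U), G(U) extend to configurations U′U for α₁ ≦ a₁ as analytic functions of A. The extended operators satisfy all the inequalities of Theorems
3.1–3.3 correspondingly.»; Theorem 3.1 (3.42) p. 397 [PDF 9] «|G′(x,x′)|, |(∇_U G′)(b,x′)|, |(G′∇*_U)(x,c)|, |(∇_U G′∇*_U)(b,c)| ≦ B₀[(Lʲη)², Lʲη, Lʲη, 1]
(L^{j′}η)^{−d}e^{−δ₀d(y,y′)} for x ∈ Δ(y), x′ ∈ Δ(y′), y ∈ Λ_j, y′ ∈ Λ_{j′}» (the printed KERNEL shape = `B6RandomWalkKernel.HasKernelBound`, kernels for the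
pairing ⟨λ,λ′⟩ = Σ η^d tr λλ′ of p. 393, block volume weight `v(y′) = (L^{j′}η)^d`); p. 402 [PDF 14] (3.60)–(3.65): «We assume that Theorem 3.1 is
valid for the operator G′(U) … the operator V′(A)G′(U) satisfies the bound |(V′(A)G′(U)λ)(x)| ≦ O(1)B₀α₁e^{−δ₀d(y,y′)} (3.63) … G′(U′U) = G′(U) +
G′(U)V′(A)G′(U′U) = G′(U) + G′(U′U)V′(A)G′(U), (3.65)»; p. 403 [PDF 15, L1–9] «Now applying Theorem 3.1 for G′(U), the bound (3.63), the
representation (3.64) and Lemma 2.1 of [4] we can prove all the statements (3.42)–(3.47) of Theorem 3.1 for the operator G′(U′U), of course with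
different constants, although changes are small. We define new constants in such a way that the statements of Theorem 3.1 hold for extended
operators.» (v1.1, r06 gen 16, 2026-08-22, DOC-ONLY: this quotation and its three echoes below made print-verbatim — summit-lit1 g79 CITELOC
QF79-001; no declaration, statement or proof touched).  [4] =
[Balaban1984PropagatorsII] T. Bałaban, *Propagators and renormalization transformations for lattice gauge theories. II*, Commun. Math. Phys. **96**
(1984) 223–250: (2.51)–(2.55) p. 232, Lemma 2.1 p. 234, (2.66) p. 234.  Rows B9.Thm3.4 × B9.Eq3.62 × B9.Thm3.1 (cells only; no head change).

WHAT IS PROVED (theorems only: 0 `def`, 0 sorry, 0 named facts; standard axioms).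
* §1 **`ineq363_kernel_vPrime`** — (3.63) WITH THE KERNEL BOUND ON THE RIGHT LETTER for the CONCRETE `V′(A)` of (3.60)
  (`B9Eq360VprimeLetters.vPrimeConc`, after real coordinates): for a right factor `T` with the kernel bounds `|T(x,x′)| ≦ B₀w(y)e^{−δd}v(y′)⁻¹`,
  `|(∇_kT)(x,x′)| ≦ B₀w(y)(Lʲη)⁻¹e^{−δd}v⁻¹` (print: `T = G′(U)·Y`, `Y ∈ {1, ∇*_l}`, `w ∈ {(Lʲη)², Lʲη}` — Theorem 3.1's (3.42)₁₋₄ in kernel form),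
  `|(V′(A)T)(x,x′)| ≦ θ₃₆₃·(Lʲη)⁻²w(y)·e^{−ρd(y,y′)}·v(y′)⁻¹` with gen 9's EXPLICIT `θ₃₆₃ = B9Ineq363Vprime.theta363` («O(1)B₀α₁»).  PROOF = gen 9's
  `B9Ineq363Vprime.ineq363_op_vPrime` with the composition device `B9Ineq385KernelConcrete.ineq385_kernel_sum` (kernel on the right letter, [4]
  (2.52)/(2.55)) in place of the block-majorant one; the `V′`-side inputs ((3.37) blockwise, transports, stencil geometry, the (3.19)/(3.58)/(3.24)
  kernel data) are gen 9's, verbatim.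
* §2 **`thm34_Gp_kernel_final`** — THEOREM 3.4's `G′(U′U)`-CLAUSE WITH THE PRINTED QUANTIFIERS AND THE FOUR (3.42) ENTRIES IN THE PRINTED KERNEL FORM:
  hypotheses = FILE 26's `B9Thm34SectBFinal.thm34_Gp_final` VERBATIM (Theorem 3.1 for `G′(U)` as the two-sided inverse of the letter `Δ′_a(U)` and as
  block majorants (3.42)₁₋₃ at the rate `δ₀`; [4] Lemma 2.1 at `δ₀` for every exponent; the p. 398 scale transfer; the `A`-free (3.19)/(3.24)/(3.60)
  data) PLUS Theorem 3.1's (3.42)₁₋₄ for `G′(U)` as KERNEL bounds (`hGpk`, `hDGpk`, `hGpDk`, `hDGpDk`); conclusion: `∃ a₁ > 0 ∃ B ≧ 0 ∀ α₁ ≦ a₁ ∀ A`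
  in (3.37) (blockwise) `∀ kF sF`: `G′(U′U) := gPrimeExtEnd G′(U) (V′(A)G′(U))` is the two-sided inverse of `Δ′_a(U) − V′(A)` and
  `|G′(U′U)(x,x′)| ≦ B(Lʲη)²e^{−(4δ₀/5)d}v(y′)⁻¹`, `|(∇_kG′(U′U))(x,x′)|, |(G′(U′U)∇*_l)(x,x′)| ≦ BLʲη e^{−(4δ₀/5)d}v⁻¹`, `|(∇_kG′(U′U)∇*_l)(x,x′)| ≦
  Be^{−(4δ₀/5)d}v⁻¹` — ONE `B`, independent of `α₁` and `A`.  PROOF («applying Theorem 3.1 for G′(U), the bound (3.63), the representation (3.64) and Lemma 2.1 of [4]», p. 403):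
  FILE 26's clause gives the inverse identities and the block majorants of every `X·G′(U′U)`; the two inverse identities give (3.65)₂ in resolvent form
  (`B9Ineq385KernelConcrete.eq386_resolvent_of_inverses`); §1 gives (3.63) in kernel form for the right factors `G′(U)·Y`; FILE 22's kernel step
  `B9Ineq385Kernel.gExt_kernelEntry_of_386` per entry `(X,Y) ∈ {1,∇_k} × {1,∇*_l}`; «of course with different constants»: `θ₃₆₃(α₁)` is continuous in
  `α₁`, hence `≦ K` below a threshold (FILE 25's `exists_bound_of_continuousAt`), and `B := B_G + B₂₆·K·Λ·c₁(δ₀,1/100)`.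

HONEST SCOPE / NOT CLAIMED.  (i) As in FILES 20–28: Theorem 3.1 FOR `U` is the INPUT (here both as block majorants, consumed by FILE 26, and as kernel
bounds, consumed by the kernel step) — the file certifies the Sect. B implication «Thm 3.1 for G′(U) ⇒ (3.42) for G′(U′U)», not Theorem 3.1 itself
(head B9.Thm3.1 stays `typed-existing`); (ii) the rate `4δ₀/5` and the exponents `1/100` are ONE admissible bookkeeping of «of course with different
constants, although changes are small. We define new constants in such a way that the statements of Theorem 3.1 hold for extended operators»
(p. 403) — the print names no formula for the new constants; a weakened rate such as `δ₀(1 − O(1)α₁)` is OUR gloss, here realised as `4δ₀/5`; (iii) the Hölder /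
L² / global entries (3.43)–(3.47) for `G′(U′U)` are not treated (GAPS G-B9-02); (iv) `a₁`, `B` are packaged existentially after the lattice is fixed
(their values depend on `d, L, δ₀, B_G` and the scale-transfer constants only, as in FILE 20 (iii)); (v) analyticity in `A` = the finite-lattice
algebra of the Neumann series (3.64) (`B9Eq373V3Analytic` has the analytic-function reading).  Value: with FILE 25 (`G(U′U)`), FILE 26 (`C⁻¹(U′U)` in
the kernel form (3.48)) and this file, the three inverse operators of Theorem 3.4 have their sup/kernel members in the PRINTED kernel form; the
remaining block-majorant-only clause is `R(U)`/`P(U′U)` ((3.49)/(3.68), FILE 27) — its kernel form needs the `P`-letters composed against this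
file's kernel entries (successor item, B9-CLOSURE §5).  NOT summit progress.

RELATED IN THE TREE, NOT DUPLICATED (searched 2026-08-22: `lean search 'Gp_kernel|ineq363_kernel' --decl` = ∅): FILE 22 `B9Ineq385Kernel`
(`gExt_kernelEntry_of_386`, the `G`-side kernel step), FILE 25 `B9Thm34GKernelFinal` (`thm34_G_kernel_final`, `exists_bound_of_continuousAt`), FILE 26
`B9Thm34SectBFinal.thm34_Gp_final`, gen 9 `B9Ineq363Vprime` (`ineq363_op_vPrime`, `theta363`), `B9Ineq385KernelConcrete` (`ineq385_kernel_sum`,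
`eq386_resolvent_of_inverses`) — all USED BY NAME.
-/

noncomputable section

namespace Literature.MathematicalPhysics.QuantumFieldTheory.Balaban1983to89.B9Thm34GpKernelFinal

open NormedSpace Complex
open Literature.MathematicalPhysics.QuantumFieldTheory.Balaban1983to89
open Literature.MathematicalPhysics.QuantumFieldTheory.Balaban1983to89.B6RandomWalk (HasMajorant hasMajorant_mono hasMajorant_zero Triangle254 Ineq261)
open Literature.MathematicalPhysics.QuantumFieldTheory.Balaban1983to89.B6RandomWalkKernel (HasKernelBound hasKernelBound_mono)
open Literature.MathematicalPhysics.QuantumFieldTheory.Balaban1983to89.B9Thm34Ext (toB6)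
open Literature.MathematicalPhysics.QuantumFieldTheory.Balaban1983to89.B9Ineq347 (ScaleTransfer)
open Literature.MathematicalPhysics.QuantumFieldTheory.Balaban1983to89.B9Eq386Neumann (vTotal)
open Literature.MathematicalPhysics.QuantumFieldTheory.Balaban1983to89.B9Ineq385VG (kappa385 kappa385_nonneg)
open Literature.MathematicalPhysics.QuantumFieldTheory.Balaban1983to89.B9Eq39Adjoint (covD covDstar)
open Literature.MathematicalPhysics.QuantumFieldTheory.Balaban1983to89.B9Eq352DivForm (tauB)
open Literature.MathematicalPhysics.QuantumFieldTheory.Balaban1983to89.B9Eq352DivFormLetters (conj)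
open Literature.MathematicalPhysics.QuantumFieldTheory.Balaban1983to89.B9Eq352GradLetters (V0op coefLetter diffLetter hasMajorant_coefLetter)
open Literature.MathematicalPhysics.QuantumFieldTheory.Balaban1983to89.B9Eq360Vprime (gPrimeExtEnd)
open Literature.MathematicalPhysics.QuantumFieldTheory.Balaban1983to89.B9Eq360VprimeLetters (avgOp vPrimeConc conj_vPrimeConc_eq_gradForm
  hasMajorant_V0_vPrime cBConc)
open Literature.MathematicalPhysics.QuantumFieldTheory.Balaban1983to89.B9Ineq363Vprime (cVConc cVConc_nonneg theta363 theta363_nonneg)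
open Literature.MathematicalPhysics.QuantumFieldTheory.Balaban1983to89.B9Ineq385Kernel (hasKernelBound_rate_mono gExt_kernelEntry_of_386)
open Literature.MathematicalPhysics.QuantumFieldTheory.Balaban1983to89.B9Ineq385KernelConcrete (eq386_resolvent_of_inverses ineq385_kernel_sum)
open Literature.MathematicalPhysics.QuantumFieldTheory.Balaban1983to89.B9Thm34SectBFinal (thm34_Gp_final)
open Literature.MathematicalPhysics.QuantumFieldTheory.Balaban1983to89.B9Thm34GKernelFinal (exists_bound_of_continuousAt)

/-! ## §1  (3.63) with the kernel bound on the right letter, for the concrete `V′(A)` of (3.60) -/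

section Kernel363

variable {𝔸 : Type*} [NormedRing 𝔸] [NormedAlgebra ℂ 𝔸] [CompleteSpace 𝔸] {ι : Type} [Fintype ι]
variable (b : Module.Basis ι ℝ 𝔸) {S : Type} {κ : Type} [Fintype κ]
variable (T : κ → Equiv.Perm S) (U : κ → S → 𝔸ˣ)
variable {g : B9.Geometry} [Fintype g.Site] {Rr : ℝ} {H : Prop}

set_option maxHeartbeats 800000 in
/-- **(3.63) WITH THE KERNEL BOUND ON THE RIGHT LETTER, FOR THE CONCRETE `V′(A)` OF (3.60)** — «the operator V′(A)G′(U) satisfies the bound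
|(V′(A)G′(U)λ)(x)| ≦ O(1)B₀α₁e^{−δ₀d(y,y′)} (3.63) for x ∈ Δ(y), supp λ ⊂ Δ(y′)» (p. 402), here composed against a right factor `T` carrying KERNEL bounds
in the printed shape of (3.42): from `|T(x,x′)| ≦ B₀w(y)e^{−δd(y,y′)}v(y′)⁻¹` and `|(∇_kT)(x,x′)| ≦ B₀w(y)(Lʲη)⁻¹e^{−δd}v(y′)⁻¹` for every concrete
difference letter `∇_k = conj b (diffLetter η⁻¹ k)` (print: `T = G′(U)`, `w = (Lʲη)²`, or `T = G′(U)∇*_U`, `w = Lʲη` — Theorem 3.1 (3.42)₁₋₄), the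
(3.37) sizes of `A` read blockwise, the transports, the stencil geometry, the (3.19)/(3.58)/(3.24) kernel data of the averaging letters, the scale
transfers of `w`, `w(Lʲη)⁻¹` at exponent `α` and [4] (2.61) at `β` (`ρ + (α+β)δ₀ ≦ δ`):
`|(V′(A)T)(x,x′)| ≦ θ₃₆₃·(Lʲη)⁻²w(y)·e^{−ρd(y,y′)}·v(y′)⁻¹`, `θ₃₆₃ = B9Ineq363Vprime.theta363` (gen 9's explicit «O(1)B₀α₁»).  Proof = gen 9's
`B9Ineq363Vprime.ineq363_op_vPrime` with `B9Ineq385KernelConcrete.ineq385_kernel_sum` ([4] (2.52)/(2.55), kernel on the right letter) as the composition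
device. [cite: Balaban1985BackgroundPropagators, (3.63) p.402 + (3.60)–(3.61) p.402 + (3.42) p.397 + (3.37) p.396 + p.403; Balaban1984PropagatorsII, (2.52)–(2.55) p.232 + Lemma 2.1 p.234] -/
theorem ineq363_kernel_vPrime [Fintype S] [DecidableEq S] [DecidableEq ι] [DecidableEq g.Site] (blk : S → g.Site) (d : ℕ) {η : ℝ} (hη : 0 < η)
    (A : κ → S → 𝔸) (kQ kF : g.Site → S → 𝔸 →L[ℝ] 𝔸) (sQ sF : S → 𝔸 →L[ℝ] 𝔸) (c w : g.Site → ℝ) (ρu d₀ M₂ C a₀ : ℝ)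
    (δ₀ δ α β ρ Λ B₀ α₁ : ℝ) (wT : g.Site → ℝ)
    (hB₀ : 0 ≤ B₀) (hα₁ : 0 ≤ α₁) (hΛ : 0 ≤ Λ) (hρ : 0 ≤ ρ) (hα : 0 ≤ α) (hβ : 0 ≤ β) (hδ₀ : 0 ≤ δ₀) (hδ : 0 ≤ δ)
    (hr : ρ + (α + β) * δ₀ ≤ δ)
    (hdnn : ∀ a a' : g.Site, 0 ≤ g.dist a a') (htri : Triangle254 (toB6 g Rr H)) (hlen : ∀ y : g.Site, 0 < g.len y)
    (h261 : Ineq261 d (toB6 g Rr H) δ₀ β) (hwT : ∀ a, 0 ≤ wT a)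
    (hT1 : ScaleTransfer g δ₀ α Λ wT) (hT2 : ScaleTransfer g δ₀ α Λ (fun a => wT a * (g.len a)⁻¹))
    (hM₂ : 0 ≤ M₂) (hrepr : ∀ (v : 𝔸) (i : ι), |b.repr v i| ≤ M₂ * ‖v‖)
    (hsmall : ∀ y : g.Site, η * (α₁ * (g.len y)⁻¹) ≤ 1 / 4)
    (hA : ∀ μ x, ‖A μ x‖ ≤ α₁ * (g.len (blk x))⁻¹ ∧ ‖tauB T U μ (A μ) x‖ ≤ α₁ * (g.len (blk x))⁻¹)
    (h337s : ∀ μ x, ‖((η : ℂ)⁻¹) • covDstar T U μ (A μ) x‖ ≤ α₁ * (g.len (blk x) ^ 2)⁻¹)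
    (hρu : ∀ μ x, ‖((U μ x : 𝔸ˣ) : 𝔸)‖ ≤ ρu ∧ ‖(((U μ x)⁻¹ : 𝔸ˣ) : 𝔸)‖ ≤ ρu)
    (hd₀ : ∀ μ x, g.dist (blk x) (blk (T μ x)) ≤ d₀ ∧ g.dist (blk x) (blk ((T μ).symm x)) ≤ d₀)
    (hd₀0 : ∀ y : g.Site, g.dist y y ≤ d₀)
    (hw : ∀ y, 0 ≤ w y) (hcard : ∀ y, ((B9Eq360Vprime.block blk y).card : ℝ) * w y ≤ 1) (hC : 0 ≤ C) (ha₀ : 0 ≤ a₀)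
    (hkQ : ∀ y x, blk x = y → ‖kQ y x‖ ≤ w y) (hkF : ∀ y x, blk x = y → ‖kF y x‖ ≤ C * α₁ * w y)
    (hsQ : ∀ x, ‖sQ x‖ ≤ 1) (hsF : ∀ x, ‖sF x‖ ≤ C * α₁) (hc : ∀ y, |c y| ≤ a₀ * (g.len y ^ 2)⁻¹)
    {v : g.Site → ℝ} (hv : ∀ y, 0 < v y) {cK : ℝ} (hcK : 0 < cK)
    {Tr : Module.End ℝ (S × ι → ℝ)}
    (hT : HasKernelBound (g := toB6 g Rr H) (fun p : S × ι => blk p.1) v cK Tr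
      (fun a a' => B₀ * wT a * Real.exp (-(δ * g.dist a a'))))
    (hDT : ∀ k : κ ⊕ κ, HasKernelBound (g := toB6 g Rr H) (fun p : S × ι => blk p.1) v cK
      (conj b (diffLetter T U ((η : ℂ)⁻¹) k) * Tr) (fun a a' => B₀ * (wT a * (g.len a)⁻¹) * Real.exp (-(δ * g.dist a a')))) :
    HasKernelBound (g := toB6 g Rr H) (fun p : S × ι => blk p.1) v cK
      (conj b (vPrimeConc T U η A blk kQ kF sQ sF c) * Tr)
      (fun a a' => theta363 (Fintype.card κ) ρu α₁ a₀ C M₂ (∑ i, ‖b i‖) (Real.exp (δ * d₀)) B₀ Λ (B6.c1 d δ₀ β) *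
        ((g.len a ^ 2)⁻¹ * wT a) * Real.exp (-(ρ * g.dist a a'))) := by
  classical
  have hSb : 0 ≤ ∑ i, ‖b i‖ := Finset.sum_nonneg fun i _ => norm_nonneg _
  have hE₀ : 0 ≤ Real.exp (δ * d₀) := Real.exp_nonneg _
  have hcB : 0 ≤ cBConc (Fintype.card κ) M₂ (∑ i, ‖b i‖) (Real.exp (δ * d₀)) := by
    unfold cBConc; positivity
  have hcC0 : 0 ≤ ((2 + 8 * ρu ^ 2 * α₁) * Fintype.card κ + a₀ * C * (2 + C * α₁)) * M₂ * (∑ i, ‖b i‖) *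
      Real.exp (δ * d₀) := by positivity
  have hcV : 0 ≤ cVConc (Fintype.card κ) ρu α₁ a₀ C M₂ (∑ i, ‖b i‖) (Real.exp (δ * d₀)) :=
    cVConc_nonneg hα₁ ha₀ hC hM₂ hSb hE₀
  -- the zeroth-order part of the concrete `V′(A)` at the constant `cVConc` (gen 9)
  have hV0 : HasMajorant (g := toB6 g Rr H) (fun p : S × ι => blk p.1)
      (conj b (V0op T U η A) - conj b (avgOp blk kQ kF sQ sF c))
      (fun y y' => cVConc (Fintype.card κ) ρu α₁ a₀ C M₂ (∑ i, ‖b i‖) (Real.exp (δ * d₀)) * α₁ * (g.len y ^ 2)⁻¹ *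
        Real.exp (-(δ * g.dist y y'))) := by
    refine hasMajorant_mono (g := toB6 g Rr H) _
      (hasMajorant_V0_vPrime b T U blk hη A kQ kF sQ sF c w ρu d₀ δ M₂ α₁ C a₀ hα₁ hδ hM₂ hrepr hlen hsmall hA h337s hρu
        hd₀ hd₀0 hw hcard hC ha₀ hkQ hkF hsQ hsF hc) fun y y' => ?_
    have hw2 : 0 ≤ (g.len y ^ 2)⁻¹ := inv_nonneg.mpr (sq_nonneg _)
    have hε : 0 ≤ Real.exp (-(δ * g.dist y y')) := Real.exp_nonneg _
    have hle : ((2 + 8 * ρu ^ 2 * α₁) * Fintype.card κ + a₀ * C * (2 + C * α₁)) * M₂ * (∑ i, ‖b i‖) *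
        Real.exp (δ * d₀) ≤ cVConc (Fintype.card κ) ρu α₁ a₀ C M₂ (∑ i, ‖b i‖) (Real.exp (δ * d₀)) := by
      unfold cVConc; linarith
    gcongr
  -- no `P₁`, `P₂` letters on the `G′`-side
  have hP : HasMajorant (g := toB6 g Rr H) (fun p : S × ι => blk p.1) (0 : Module.End ℝ (S × ι → ℝ))
      (fun a a' => 0 * α₁ * (g.len a ^ 2)⁻¹ * Real.exp (-(δ * g.dist a a'))) :=
    hasMajorant_mono (g := toB6 g Rr H) _ (hasMajorant_zero (g := toB6 g Rr H) _) fun a a' => le_of_eq (by ring)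
  have h := ineq385_kernel_sum (R := Rr) (H := H) (fun p : S × ι => blk p.1) d (Finset.univ : Finset (κ ⊕ κ)) δ₀ δ α β ρ Λ
    B₀ (cVConc (Fintype.card κ) ρu α₁ a₀ C M₂ (∑ i, ‖b i‖) (Real.exp (δ * d₀))) 0 0 α₁
    (fun _ => 2 * M₂ * (∑ i, ‖b i‖) * Real.exp (δ * d₀)) wT hB₀ hcV le_rfl le_rfl hα₁ hΛ hρ hα hβ hδ₀ hr hwT
    (fun _ _ => by positivity) ?_ hdnn htri hlen h261 hT1 hT2 hv hcK (P₁ := 0) (P₂ := 0)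
    (V1 := fun k => conj b (coefLetter T U A k)) (D := fun k => conj b (diffLetter T U ((η : ℂ)⁻¹) k))
    (conj_vPrimeConc_eq_gradForm b T U η A blk kQ kF sQ sF c) hV0
    (fun k _ => hasMajorant_coefLetter b T U blk A d₀ δ M₂ α₁ hα₁ hδ hM₂ hrepr hlen hA hd₀0 k) hP hP hT (fun k _ => hDT k)
  · have e : vTotal (conj b (vPrimeConc T U η A blk kQ kF sQ sF c)) (0 : Module.End ℝ (S × ι → ℝ)) 0 * Tr =
        conj b (vPrimeConc T U η A blk kQ kF sQ sF c) * Tr := by simp [vTotal]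
    rw [e] at h
    exact hasKernelBound_mono (g := toB6 g Rr H) _ hv h fun a a' => le_of_eq (by simp only [theta363])
  · rw [Finset.sum_const, Finset.card_univ, Fintype.card_sum, nsmul_eq_mul, Nat.cast_add, cVConc, cBConc]
    nlinarith [hcC0]

end Kernel363

/-! ## §2  Theorem 3.4, the `G′(U′U)`-clause: the four (3.42) entries of `G′(U′U)` in the printed kernel form, printed quantifiers -/

section Final

variable {𝔸 : Type*} [NormedRing 𝔸] [NormedAlgebra ℂ 𝔸] [CompleteSpace 𝔸] {ι : Type} [Fintype ι]
variable (b : Module.Basis ι ℝ 𝔸) {S : Type} {κ : Type} [Fintype κ]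
variable (T : κ → Equiv.Perm S) (U : κ → S → 𝔸ˣ)
variable {g : B9.Geometry} [Fintype g.Site] {Rr : ℝ} {H : Prop}

set_option maxHeartbeats 1600000 in
/-- **THEOREM 3.4, `G′(U′U)`-CLAUSE: ALL FOUR ENTRIES (3.42)₁₋₄ OF `G′(U′U)` IN THE PRINTED KERNEL FORM, PRINTED QUANTIFIERS** — «There exists a
positive constant a₁ such that the operators G′(U), (Q′(U)G′²(U)Q′*(U))⁻¹, R(U), G(U) extend to configurations U′U for α₁ ≦ a₁ as analytic functions
of A. The extended operators satisfy all the inequalities of Theorems 3.1–3.3 correspondingly» (p. 400), for the `G′(U′U)`-part with «Now applying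
Theorem 3.1 for G′(U), the bound (3.63), the representation (3.64) and Lemma 2.1 of [4] we can prove all the statements (3.42)–(3.47) of Theorem
3.1 for the operator G′(U′U), of course with different constants» (p. 403): hypotheses = FILE 26's `thm34_Gp_final` VERBATIM plus Theorem 3.1's (3.42)₁₋₄ for `G′(U)` as KERNEL
bounds (pairing weight `c`, block volume weight `v > 0`); conclusion: `∃ a₁ > 0 ∃ B ≧ 0 ∀ α₁ ≦ a₁ ∀ A` in (3.37) (blockwise) `∀ kF sF`: `G′(U′U)` is the
two-sided inverse of `Δ′_a(U) − V′(A)` and `|G′(U′U)(x,x′)| ≦ B(Lʲη)²e^{−(4δ₀/5)d(y,y′)}v(y′)⁻¹`, `|(∇_kG′(U′U))(x,x′)|, |(G′(U′U)∇*_l)(x,x′)| ≦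
BLʲη e^{−(4δ₀/5)d}v(y′)⁻¹`, `|(∇_kG′(U′U)∇*_l)(x,x′)| ≦ Be^{−(4δ₀/5)d}v(y′)⁻¹` — ONE `B`, independent of `α₁` and `A`.  PROOF: FILE 26 (inverse
identities, block majorants of `X·G′(U′U)`), (3.65)₂ in resolvent form from the inverse identities, §1 for the right factors `G′(U)·Y`, FILE 22's
kernel step per entry, `θ₃₆₃(α₁) ≦ K` below a threshold by continuity.
[cite: Balaban1985BackgroundPropagators, Thm 3.4 p.400 + Thm 3.1 (3.42) p.397 + (3.60)–(3.65) p.402 + p.403 + p.398 remark + (3.19) p.393 + (3.24) p.394 + (3.59) p.402 + (3.37) p.396; Balaban1984PropagatorsII, Lemma 2.1 p.234 + (2.51)–(2.55) p.232 + (2.66) p.234] -/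

theorem thm34_Gp_kernel_final [Fintype S] [DecidableEq S] [DecidableEq ι] [DecidableEq g.Site] [Nonempty g.Site] (blk : S → g.Site) (d : ℕ)
    (δ₀ BG Cq a₀ d₀ M₂ : ℝ)
    (kQ : g.Site → S → 𝔸 →L[ℝ] 𝔸) (sQ : S → 𝔸 →L[ℝ] 𝔸) (cfun w : g.Site → ℝ)
    (hBG : 0 < BG) (hCq : 0 ≤ Cq) (ha₀ : 0 ≤ a₀) (hM₂ : 0 ≤ M₂) (hδ₀ : 0 < δ₀)
    -- the multiscale geometry 𝔅 (p. 393, [4] (2.1)–(2.4)) and its axioms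
    (hdnn : ∀ a a' : g.Site, 0 ≤ g.dist a a') (htri : Triangle254 (toB6 g Rr H)) (hrefl : ∀ y : g.Site, g.dist y y = 0)
    (hsym : ∀ y y' : g.Site, g.dist y y' = g.dist y' y) (hlen : ∀ y : g.Site, 0 < g.len y) (hlenη : ∀ y : g.Site, g.eta ≤ g.len y)
    (hη : 0 < g.eta)
    -- [4] Lemma 2.1 (2.61) at the rate `δ₀`, «for every 0 < α < 1», and the p. 398 scale transfer for every exponent
    (h261 : ∀ α : ℝ, 0 < α → α < 1 → Ineq261 d (toB6 g Rr H) δ₀ α)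
    (hST : ∀ α : ℝ, 0 < α → ∃ Λ : ℝ, 1 ≤ Λ ∧ ScaleTransfer g δ₀ α Λ (fun a => g.len a) ∧ ScaleTransfer g δ₀ α Λ (fun a => g.len a ^ 2) ∧
      ScaleTransfer g δ₀ α Λ (fun a => (g.len a)⁻¹) ∧ ScaleTransfer g δ₀ α Λ (fun a => (g.len a ^ 2)⁻¹) ∧
      ScaleTransfer g δ₀ α Λ (fun a => (g.len a ^ 4)⁻¹) ∧ ScaleTransfer g δ₀ α Λ (fun y => g.len y ^ (-(4 : ℝ))))
    (hrepr : ∀ (v : 𝔸) (i : ι), |b.repr v i| ≤ M₂ * ‖v‖)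
    (hU1 : ∀ m z, ‖((U m z : 𝔸ˣ) : 𝔸)‖ ≤ 1 ∧ ‖(((U m z)⁻¹ : 𝔸ˣ) : 𝔸)‖ ≤ 1)
    (hd₀B : ∀ μ x, g.dist (blk x) (blk ((T μ).symm x)) ≤ d₀) (hd₀F : ∀ μ x, g.dist (blk x) (blk (T μ x)) ≤ d₀)
    (hd₀0 : ∀ y : g.Site, g.dist y y ≤ d₀)
    -- the `A`-independent data of the concrete `V′(A)` of (3.60)
    (hw : ∀ y, 0 ≤ w y) (hcard : ∀ y, ((B9Eq360Vprime.block blk y).card : ℝ) * w y ≤ 1)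
    (hkQ : ∀ y x, blk x = y → ‖kQ y x‖ ≤ w y) (hsQ : ∀ x, ‖sQ x‖ ≤ 1) (hcfun : ∀ y, |cfun y| ≤ a₀ * (g.len y ^ 2)⁻¹)
    -- THEOREM 3.1 for `G′(U)`: (3.24) `G′(U) = (Δ′_a(U))⁻¹` for the letter `Δ′_a(U)`, and (3.42)₁,₂,₃ at the rate `δ₀`
    {Δp Gp : Module.End ℝ (S × ι → ℝ)} (hΔpGp : Δp * Gp = 1) (hGpΔp : Gp * Δp = 1)
    (h342_1 : HasMajorant (g := toB6 g Rr H) (fun p : S × ι => blk p.1) Gp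
      (fun a a' => BG * g.len a ^ 2 * Real.exp (-(δ₀ * g.dist a a'))))
    (h342_2 : ∀ k : κ ⊕ κ, HasMajorant (g := toB6 g Rr H) (fun p : S × ι => blk p.1)
      (conj b (diffLetter T U ((g.eta : ℂ)⁻¹) k) * Gp) (fun a a' => BG * g.len a * Real.exp (-(δ₀ * g.dist a a'))))
    (h342_3 : ∀ k : κ ⊕ κ, HasMajorant (g := toB6 g Rr H) (fun p : S × ι => blk p.1)
      (Gp * conj b (diffLetter T U ((g.eta : ℂ)⁻¹) k)) (fun a a' => BG * g.len a * Real.exp (-(δ₀ * g.dist a a'))))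
    -- the kernel pairing of p. 393 (`c = η^d`, block volume weight `v(y′) = (L^{j′}η)^d`) and THEOREM 3.1's (3.42)₁₋₄ FOR `G′(U)` IN THE PRINTED KERNEL FORM
    {v : g.Site → ℝ} (hv : ∀ y, 0 < v y) {cK : ℝ} (hcK : 0 < cK)
    (hGpk : HasKernelBound (g := toB6 g Rr H) (fun p : S × ι => blk p.1) v cK Gp
      (fun a a' => BG * g.len a ^ 2 * Real.exp (-(δ₀ * g.dist a a'))))
    (hDGpk : ∀ k : κ ⊕ κ, HasKernelBound (g := toB6 g Rr H) (fun p : S × ι => blk p.1) v cK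
      (conj b (diffLetter T U ((g.eta : ℂ)⁻¹) k) * Gp) (fun a a' => BG * g.len a * Real.exp (-(δ₀ * g.dist a a'))))
    (hGpDk : ∀ l : κ ⊕ κ, HasKernelBound (g := toB6 g Rr H) (fun p : S × ι => blk p.1) v cK
      (Gp * conj b (diffLetter T U ((g.eta : ℂ)⁻¹) l)) (fun a a' => BG * g.len a * Real.exp (-(δ₀ * g.dist a a'))))
    (hDGpDk : ∀ k l : κ ⊕ κ, HasKernelBound (g := toB6 g Rr H) (fun p : S × ι => blk p.1) v cK
      (conj b (diffLetter T U ((g.eta : ℂ)⁻¹) k) * Gp * conj b (diffLetter T U ((g.eta : ℂ)⁻¹) l)) (fun a a' => BG * Real.exp (-(δ₀ * g.dist a a')))) :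
    ∃ a₁ : ℝ, 0 < a₁ ∧ ∃ B : ℝ, 0 ≤ B ∧
    ∀ (α₁ : ℝ), 0 ≤ α₁ → α₁ ≤ a₁ →
    -- the exponent field `A` in the domain (3.37), read blockwise, and the `A`-dependent (3.59) data `kF`, `sF`
    ∀ (A : κ → S → 𝔸) (kF : g.Site → S → 𝔸 →L[ℝ] 𝔸) (sF : S → 𝔸 →L[ℝ] 𝔸),
      (∀ y x, blk x = y → ‖kF y x‖ ≤ Cq * α₁ * w y) → (∀ x, ‖sF x‖ ≤ Cq * α₁) →
      (∀ ν k x, ‖((g.eta : ℂ)⁻¹) • covDstar T U ν (A k) x‖ ≤ α₁ * (g.len (blk x) ^ 2)⁻¹) →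
      (∀ μ ν x, ‖((g.eta : ℂ)⁻¹) • covD T U μ (A ν) x‖ ≤ α₁ * (g.len (blk x) ^ 2)⁻¹) →
      (∀ μ x, ‖((g.eta : ℂ)⁻¹) • covDstar T U μ (tauB T U μ (A μ)) x‖ ≤ α₁ * (g.len (blk x) ^ 2)⁻¹) →
      (∀ k x, ‖A k x‖ ≤ α₁ * (g.len (blk x))⁻¹) → (∀ ν k x, ‖tauB T U ν (A k) x‖ ≤ α₁ * (g.len (blk x))⁻¹) →
      (Δp - conj b (vPrimeConc T U g.eta A blk kQ kF sQ sF cfun)) * (gPrimeExtEnd Gp (conj b (vPrimeConc T U g.eta A blk kQ kF sQ sF cfun) * Gp)) = 1 ∧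
      (gPrimeExtEnd Gp (conj b (vPrimeConc T U g.eta A blk kQ kF sQ sF cfun) * Gp)) * (Δp - conj b (vPrimeConc T U g.eta A blk kQ kF sQ sF cfun)) = 1 ∧
      HasKernelBound (g := toB6 g Rr H) (fun p : S × ι => blk p.1) v cK (gPrimeExtEnd Gp (conj b (vPrimeConc T U g.eta A blk kQ kF sQ sF cfun) * Gp))
        (fun a a' => B * g.len a ^ 2 * Real.exp (-(4 / 5 * δ₀ * g.dist a a'))) ∧
      (∀ k : κ ⊕ κ, HasKernelBound (g := toB6 g Rr H) (fun p : S × ι => blk p.1) v cK (conj b (diffLetter T U ((g.eta : ℂ)⁻¹) k) * (gPrimeExtEnd Gp (conj b (vPrimeConc T U g.eta A blk kQ kF sQ sF cfun) * Gp)))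
        (fun a a' => B * g.len a * Real.exp (-(4 / 5 * δ₀ * g.dist a a')))) ∧
      (∀ l : κ ⊕ κ, HasKernelBound (g := toB6 g Rr H) (fun p : S × ι => blk p.1) v cK ((gPrimeExtEnd Gp (conj b (vPrimeConc T U g.eta A blk kQ kF sQ sF cfun) * Gp)) * conj b (diffLetter T U ((g.eta : ℂ)⁻¹) l))
        (fun a a' => B * g.len a * Real.exp (-(4 / 5 * δ₀ * g.dist a a')))) ∧
      (∀ k l : κ ⊕ κ, HasKernelBound (g := toB6 g Rr H) (fun p : S × ι => blk p.1) v cK (conj b (diffLetter T U ((g.eta : ℂ)⁻¹) k) * (gPrimeExtEnd Gp (conj b (vPrimeConc T U g.eta A blk kQ kF sQ sF cfun) * Gp)) * conj b (diffLetter T U ((g.eta : ℂ)⁻¹) l))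
        (fun a a' => B * Real.exp (-(4 / 5 * δ₀ * g.dist a a')))) := by
  classical
  -- FILE 26: thresholds, the constant `B`, the two inverse identities and the universal left block-majorant clause for `G′(U′U)`
  obtain ⟨a₁, ha₁, B, hB, hfin⟩ := thm34_Gp_final (Rr := Rr) (H := H) b T U blk d δ₀ BG Cq a₀ d₀ M₂ kQ sQ cfun w hBG hCq ha₀ hM₂ hδ₀
    hdnn htri hrefl hsym hlen hlenη hη h261 hST hrepr hU1 hd₀B hd₀F hd₀0 hw hcard hkQ hsQ hcfun hΔpGp hGpΔp h342_1 h342_2 h342_3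
  -- the p. 398 scale transfers and [4] Lemma 2.1 at exponent `1/100`
  obtain ⟨Λ, hΛ1, hT1, hT2, hT1i, -, -, -⟩ := hST (1 / 100) (by norm_num)
  have hΛ0 : 0 ≤ Λ := zero_le_one.trans hΛ1
  have h261β : Ineq261 d (toB6 g Rr H) δ₀ (1 / 100) := h261 _ (by norm_num) (by norm_num)
  have hc1 : 0 ≤ B6.c1 d δ₀ (1 / 100) := B6RandomWalk.c1_nonneg d δ₀ (1 / 100)
  -- «of course with different constants» (p. 403): `θ₃₆₃(α₁)` is continuous in `α₁`, hence `≦ K` below a threshold `ε`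
  obtain ⟨K, ε, hK, hε, hKb⟩ := exists_bound_of_continuousAt
    (f := fun α₁ : ℝ => theta363 (Fintype.card κ) 1 α₁ a₀ Cq M₂ (∑ i, ‖b i‖) (Real.exp (δ₀ * d₀)) BG Λ (B6.c1 d δ₀ (1 / 100)))
    (by unfold theta363 kappa385 cVConc cBConc; fun_prop)
  have hB' : 0 ≤ BG + B * K * Λ * B6.c1 d δ₀ (1 / 100) :=
    add_nonneg hBG.le (mul_nonneg (mul_nonneg (mul_nonneg hB hK) hΛ0) hc1)
  refine ⟨min a₁ (min (ε / 2) (1 / 4)), lt_min ha₁ (lt_min (half_pos hε) (by norm_num)), BG + B * K * Λ * B6.c1 d δ₀ (1 / 100), hB', ?_⟩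
  intro α₁ hα₁0 hα₁1 A kF sF hkF hsF h337B h337F h337Bτ hA hAτB
  have hα₁a : α₁ ≤ a₁ := hα₁1.trans (min_le_left _ _)
  have hα₁ε : α₁ ≤ ε / 2 := hα₁1.trans ((min_le_right _ _).trans (min_le_left _ _))
  have hα₁q : α₁ ≤ 1 / 4 := hα₁1.trans ((min_le_right _ _).trans (min_le_right _ _))
  obtain ⟨i1, i2, hL, -⟩ := hfin α₁ hα₁0 hα₁a A kF sF hkF hsF h337B h337F h337Bτ hA hAτB
  have hθK : theta363 (Fintype.card κ) 1 α₁ a₀ Cq M₂ (∑ i, ‖b i‖) (Real.exp (δ₀ * d₀)) BG Λ (B6.c1 d δ₀ (1 / 100)) ≤ K :=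
    hKb α₁ (by rw [abs_of_nonneg hα₁0]; linarith)
  -- (3.65)₂ in resolvent form, from the two inverse identities: `G′(U′U) = G′(U) + G′(U′U)·(V′(A)G′(U))`
  have h365 : gPrimeExtEnd Gp (conj b (vPrimeConc T U g.eta A blk kQ kF sQ sF cfun) * Gp) = Gp + (gPrimeExtEnd Gp (conj b (vPrimeConc T U g.eta A blk kQ kF sQ sF cfun) * Gp)) * (conj b (vPrimeConc T U g.eta A blk kQ kF sQ sF cfun) * Gp) :=
    eq386_resolvent_of_inverses (Δ := Δp) (Δ' := Δp - conj b (vPrimeConc T U g.eta A blk kQ kF sQ sF cfun)) (V := conj b (vPrimeConc T U g.eta A blk kQ kF sQ sF cfun)) hΔpGp i2 rfl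
  -- the shapes in which §1 reads (3.37), the transports and the stencil geometry
  have hsmall : ∀ y : g.Site, g.eta * (α₁ * (g.len y)⁻¹) ≤ 1 / 4 := fun y => by
    have hq : g.eta * (g.len y)⁻¹ ≤ 1 := by
      rw [← div_eq_mul_inv]; exact (div_le_one (hlen y)).mpr (hlenη y)
    calc g.eta * (α₁ * (g.len y)⁻¹) = α₁ * (g.eta * (g.len y)⁻¹) := by ring
      _ ≤ α₁ * 1 := mul_le_mul_of_nonneg_left hq hα₁0
      _ ≤ 1 / 4 := by linarith
  have hA' : ∀ μ x, ‖A μ x‖ ≤ α₁ * (g.len (blk x))⁻¹ ∧ ‖tauB T U μ (A μ) x‖ ≤ α₁ * (g.len (blk x))⁻¹ :=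
    fun μ x => ⟨hA μ x, hAτB μ μ x⟩
  have h337s' : ∀ μ x, ‖((g.eta : ℂ)⁻¹) • covDstar T U μ (A μ) x‖ ≤ α₁ * (g.len (blk x) ^ 2)⁻¹ := fun μ x => h337B μ μ x
  have hd₀' : ∀ μ x, g.dist (blk x) (blk (T μ x)) ≤ d₀ ∧ g.dist (blk x) (blk ((T μ).symm x)) ≤ d₀ :=
    fun μ x => ⟨hd₀F μ x, hd₀B μ x⟩
  -- elementary identities for the weights `(Lʲη)², Lʲη, 1, (Lʲη)⁻¹`
  have hl21 : ∀ a : g.Site, g.len a ^ 2 * (g.len a)⁻¹ = g.len a := fun a => by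
    rw [pow_two, mul_assoc, mul_inv_cancel₀ (hlen a).ne', mul_one]
  have hl10 : ∀ a : g.Site, g.len a * (g.len a)⁻¹ = 1 := fun a => mul_inv_cancel₀ (hlen a).ne'
  have hl22 : ∀ a : g.Site, (g.len a ^ 2)⁻¹ * g.len a ^ 2 = 1 := fun a => inv_mul_cancel₀ (pow_ne_zero 2 (hlen a).ne')
  have hl2i1 : ∀ a : g.Site, (g.len a ^ 2)⁻¹ * g.len a = (g.len a)⁻¹ := fun a => by
    rw [pow_two, mul_inv, mul_assoc, inv_mul_cancel₀ (hlen a).ne', mul_one]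
  -- scale transfers for the weights `(Lʲη)²·(Lʲη)⁻¹ = Lʲη`, `Lʲη·(Lʲη)⁻¹ = 1` and `1`
  have hSTone : ScaleTransfer g δ₀ (1 / 100) Λ (fun _ : g.Site => (1 : ℝ)) := fun y y' => by
    simp only [mul_one]
    have h0 : 0 ≤ 1 / 100 * δ₀ * g.dist y y' := mul_nonneg (mul_nonneg (by norm_num) hδ₀.le) (hdnn y y')
    exact (Real.exp_le_one_iff.mpr (by linarith)).trans hΛ1
  have hw21 : (fun a : g.Site => g.len a ^ 2 * (g.len a)⁻¹) = fun a => g.len a := funext hl21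
  have hw10 : (fun a : g.Site => g.len a * (g.len a)⁻¹) = fun _ => (1 : ℝ) := funext hl10
  have hT21 : ScaleTransfer g δ₀ (1 / 100) Λ (fun a : g.Site => g.len a ^ 2 * (g.len a)⁻¹) := by rw [hw21]; exact hT1
  have hT10 : ScaleTransfer g δ₀ (1 / 100) Λ (fun a : g.Site => g.len a * (g.len a)⁻¹) := by rw [hw10]; exact hSTone
  have hρ1 : 49 / 50 * δ₀ + (1 / 100 + 1 / 100) * δ₀ ≤ δ₀ := by linarith
  have hρ10 : 0 ≤ 49 / 50 * δ₀ := by linarith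
  -- Theorem 3.1's kernel entries of `G′(U)` in the weight shapes §1 reads
  have hDGpk' : ∀ k : κ ⊕ κ, HasKernelBound (g := toB6 g Rr H) (fun p : S × ι => blk p.1) v cK (conj b (diffLetter T U ((g.eta : ℂ)⁻¹) k) * Gp)
      (fun a a' => BG * (g.len a ^ 2 * (g.len a)⁻¹) * Real.exp (-(δ₀ * g.dist a a'))) := fun k =>
    hasKernelBound_mono (g := toB6 g Rr H) _ hv (hDGpk k) fun a a' => le_of_eq (by rw [hl21])
  have hDGpDk' : ∀ k l : κ ⊕ κ, HasKernelBound (g := toB6 g Rr H) (fun p : S × ι => blk p.1) v cK (conj b (diffLetter T U ((g.eta : ℂ)⁻¹) k) * Gp * conj b (diffLetter T U ((g.eta : ℂ)⁻¹) l))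
      (fun a a' => BG * (g.len a * (g.len a)⁻¹) * Real.exp (-(δ₀ * g.dist a a'))) := fun k l =>
    hasKernelBound_mono (g := toB6 g Rr H) _ hv (hDGpDk k l) fun a a' => le_of_eq (by rw [hl10, mul_one])
  -- §1: (3.63) with the kernel on the right letter, right factors `G′(U)` (`w = (Lʲη)²`) and `G′(U)∇*_l` (`w = Lʲη`), at the rate `49δ₀/50`
  have k1 : HasKernelBound (g := toB6 g Rr H) (fun p : S × ι => blk p.1) v cK (conj b (vPrimeConc T U g.eta A blk kQ kF sQ sF cfun) * Gp)
      (fun a a' => theta363 (Fintype.card κ) 1 α₁ a₀ Cq M₂ (∑ i, ‖b i‖) (Real.exp (δ₀ * d₀)) BG Λ (B6.c1 d δ₀ (1 / 100)) * ((g.len a ^ 2)⁻¹ * g.len a ^ 2) * Real.exp (-(49 / 50 * δ₀ * g.dist a a'))) :=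
    ineq363_kernel_vPrime (Rr := Rr) (H := H) b T U blk d hη A kQ kF sQ sF cfun w 1 d₀ M₂ Cq a₀ δ₀ δ₀ (1 / 100) (1 / 100)
      (49 / 50 * δ₀) Λ BG α₁ (fun a => g.len a ^ 2) hBG.le hα₁0 hΛ0 hρ10 (by norm_num) (by norm_num) hδ₀.le hδ₀.le hρ1 hdnn htri hlen h261β
      (fun a => sq_nonneg _) hT2 hT21 hM₂ hrepr hsmall hA' h337s' hU1 hd₀' hd₀0 hw hcard hCq ha₀ hkQ hkF hsQ hsF hcfun hv hcK
      (Tr := Gp) hGpk hDGpk'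
  have k3 : ∀ l : κ ⊕ κ, HasKernelBound (g := toB6 g Rr H) (fun p : S × ι => blk p.1) v cK (conj b (vPrimeConc T U g.eta A blk kQ kF sQ sF cfun) * (Gp * conj b (diffLetter T U ((g.eta : ℂ)⁻¹) l)))
      (fun a a' => theta363 (Fintype.card κ) 1 α₁ a₀ Cq M₂ (∑ i, ‖b i‖) (Real.exp (δ₀ * d₀)) BG Λ (B6.c1 d δ₀ (1 / 100)) * ((g.len a ^ 2)⁻¹ * g.len a) * Real.exp (-(49 / 50 * δ₀ * g.dist a a'))) := fun l =>
    ineq363_kernel_vPrime (Rr := Rr) (H := H) b T U blk d hη A kQ kF sQ sF cfun w 1 d₀ M₂ Cq a₀ δ₀ δ₀ (1 / 100) (1 / 100)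
      (49 / 50 * δ₀) Λ BG α₁ (fun a => g.len a) hBG.le hα₁0 hΛ0 hρ10 (by norm_num) (by norm_num) hδ₀.le hδ₀.le hρ1 hdnn htri hlen h261β
      (fun a => (hlen a).le) hT1 hT10 hM₂ hrepr hsmall hA' h337s' hU1 hd₀' hd₀0 hw hcard hCq ha₀ hkQ hkF hsQ hsF hcfun hv hcK
      (Tr := Gp * conj b (diffLetter T U ((g.eta : ℂ)⁻¹) l)) (hGpDk l) (fun k => by simpa only [mul_assoc] using hDGpDk' k l)
  -- … weakened to the constant `K` and the rate `4δ₀/5`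
  have hexp : ∀ a a' : g.Site, Real.exp (-(49 / 50 * δ₀ * g.dist a a')) ≤ Real.exp (-(4 / 5 * δ₀ * g.dist a a')) := fun a a' => by
    have h0 : 0 ≤ δ₀ * g.dist a a' := mul_nonneg hδ₀.le (hdnn a a')
    exact Real.exp_le_exp.mpr (by linarith)
  have e1 : conj b (vPrimeConc T U g.eta A blk kQ kF sQ sF cfun) * Gp * (1 : Module.End ℝ (S × ι → ℝ)) = conj b (vPrimeConc T U g.eta A blk kQ kF sQ sF cfun) * Gp := mul_one _
  have k1' : HasKernelBound (g := toB6 g Rr H) (fun p : S × ι => blk p.1) v cK (conj b (vPrimeConc T U g.eta A blk kQ kF sQ sF cfun) * Gp * 1)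
      (fun a a' => K * (1 : ℝ) * Real.exp (-(4 / 5 * δ₀ * g.dist a a'))) := by
    rw [e1]
    refine hasKernelBound_mono (g := toB6 g Rr H) _ hv k1 fun a a' => ?_
    rw [hl22, mul_one, mul_one]
    exact mul_le_mul hθK (hexp a a') (Real.exp_pos _).le hK
  have e3 : ∀ l : κ ⊕ κ, conj b (vPrimeConc T U g.eta A blk kQ kF sQ sF cfun) * Gp * conj b (diffLetter T U ((g.eta : ℂ)⁻¹) l) = conj b (vPrimeConc T U g.eta A blk kQ kF sQ sF cfun) * (Gp * conj b (diffLetter T U ((g.eta : ℂ)⁻¹) l)) := fun l => mul_assoc _ _ _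
  have k3' : ∀ l : κ ⊕ κ, HasKernelBound (g := toB6 g Rr H) (fun p : S × ι => blk p.1) v cK (conj b (vPrimeConc T U g.eta A blk kQ kF sQ sF cfun) * Gp * conj b (diffLetter T U ((g.eta : ℂ)⁻¹) l))
      (fun a a' => K * (g.len a)⁻¹ * Real.exp (-(4 / 5 * δ₀ * g.dist a a'))) := fun l => by
    rw [e3 l]
    refine hasKernelBound_mono (g := toB6 g Rr H) _ hv (k3 l) fun a a' => ?_
    rw [hl2i1]
    exact mul_le_mul (mul_le_mul_of_nonneg_right hθK (inv_nonneg.mpr (hlen a).le)) (hexp a a') (Real.exp_pos _).le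
      (mul_nonneg hK (inv_nonneg.mpr (hlen a).le))
  -- rate bookkeeping of the kernel step: `r = δ₀`, `r′ = 9δ₀/10` (FILE 26), `ρ = 4δ₀/5`, `α = β = 1/100`
  have hr' : 4 / 5 * δ₀ + (1 / 100 + 1 / 100) * δ₀ ≤ 9 / 10 * δ₀ := by linarith
  have hrρ : 4 / 5 * δ₀ ≤ δ₀ := by linarith
  have hρ0 : 0 ≤ 4 / 5 * δ₀ := by linarith
  refine ⟨i1, i2, ?_, fun k => ?_, fun l => ?_, fun k l => ?_⟩
  · -- (3.42)₁: `(X, Y) = (1, 1)`, `P = (Lʲη)²`, `Q = 1`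
    have h342 : HasKernelBound (g := toB6 g Rr H) (fun p : S × ι => blk p.1) v cK (1 * Gp * 1)
        (fun a a' => BG * (g.len a ^ 2 * (1 : ℝ)) * Real.exp (-(δ₀ * g.dist a a'))) := by
      simpa only [one_mul, mul_one] using hGpk
    have hX : HasMajorant (g := toB6 g Rr H) (fun p : S × ι => blk p.1) (1 * gPrimeExtEnd Gp (conj b (vPrimeConc T U g.eta A blk kQ kF sQ sF cfun) * Gp))
        (fun a a' => B * g.len a ^ 2 * Real.exp (-(9 / 10 * δ₀ * g.dist a a'))) :=
      hL 1 (fun a => g.len a ^ 2) (fun a => sq_nonneg _) (by simpa only [one_mul] using h342_1)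
    have h := gExt_kernelEntry_of_386 (R := Rr) (H := H) (fun p : S × ι => blk p.1) d δ₀ (1 / 100) (1 / 100) (4 / 5 * δ₀) δ₀
      (9 / 10 * δ₀) Λ BG B K (fun a => g.len a ^ 2) (fun _ => (1 : ℝ)) hBG.le hB hK (fun a => sq_nonneg _) (fun _ => zero_le_one)
      hΛ0 hρ0 hr' hrρ hdnn htri hSTone h261β hv hcK h365 h342 hX k1'
    simpa only [one_mul, mul_one] using h
  · -- (3.42)₂: `(X, Y) = (∇_k, 1)`, `P = Lʲη`, `Q = 1`
    have h342 : HasKernelBound (g := toB6 g Rr H) (fun p : S × ι => blk p.1) v cK (conj b (diffLetter T U ((g.eta : ℂ)⁻¹) k) * Gp * 1)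
        (fun a a' => BG * (g.len a * (1 : ℝ)) * Real.exp (-(δ₀ * g.dist a a'))) := by
      simpa only [mul_one] using hDGpk k
    have hX : HasMajorant (g := toB6 g Rr H) (fun p : S × ι => blk p.1) (conj b (diffLetter T U ((g.eta : ℂ)⁻¹) k) * gPrimeExtEnd Gp (conj b (vPrimeConc T U g.eta A blk kQ kF sQ sF cfun) * Gp))
        (fun a a' => B * g.len a * Real.exp (-(9 / 10 * δ₀ * g.dist a a'))) :=
      hL _ (fun a => g.len a) (fun a => (hlen a).le) (h342_2 k)
    have h := gExt_kernelEntry_of_386 (R := Rr) (H := H) (fun p : S × ι => blk p.1) d δ₀ (1 / 100) (1 / 100) (4 / 5 * δ₀) δ₀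
      (9 / 10 * δ₀) Λ BG B K (fun a => g.len a) (fun _ => (1 : ℝ)) hBG.le hB hK (fun a => (hlen a).le) (fun _ => zero_le_one)
      hΛ0 hρ0 hr' hrρ hdnn htri hSTone h261β hv hcK h365 h342 hX k1'
    simpa only [mul_one] using h
  · -- (3.42)₃: `(X, Y) = (1, ∇*_l)`, `P = (Lʲη)²`, `Q = (Lʲη)⁻¹`
    have h342 : HasKernelBound (g := toB6 g Rr H) (fun p : S × ι => blk p.1) v cK (1 * Gp * conj b (diffLetter T U ((g.eta : ℂ)⁻¹) l))
        (fun a a' => BG * (g.len a ^ 2 * (g.len a)⁻¹) * Real.exp (-(δ₀ * g.dist a a'))) := by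
      simpa only [one_mul, hl21] using hGpDk l
    have hX : HasMajorant (g := toB6 g Rr H) (fun p : S × ι => blk p.1) (1 * gPrimeExtEnd Gp (conj b (vPrimeConc T U g.eta A blk kQ kF sQ sF cfun) * Gp))
        (fun a a' => B * g.len a ^ 2 * Real.exp (-(9 / 10 * δ₀ * g.dist a a'))) :=
      hL 1 (fun a => g.len a ^ 2) (fun a => sq_nonneg _) (by simpa only [one_mul] using h342_1)
    have h := gExt_kernelEntry_of_386 (R := Rr) (H := H) (fun p : S × ι => blk p.1) d δ₀ (1 / 100) (1 / 100) (4 / 5 * δ₀) δ₀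
      (9 / 10 * δ₀) Λ BG B K (fun a => g.len a ^ 2) (fun a => (g.len a)⁻¹) hBG.le hB hK (fun a => sq_nonneg _)
      (fun a => inv_nonneg.mpr (hlen a).le) hΛ0 hρ0 hr' hrρ hdnn htri hT1i h261β hv hcK h365 h342 hX (k3' l)
    simpa only [one_mul, hl21] using h
  · -- (3.42)₄: `(X, Y) = (∇_k, ∇*_l)`, `P = Lʲη`, `Q = (Lʲη)⁻¹`
    have h342 : HasKernelBound (g := toB6 g Rr H) (fun p : S × ι => blk p.1) v cK (conj b (diffLetter T U ((g.eta : ℂ)⁻¹) k) * Gp * conj b (diffLetter T U ((g.eta : ℂ)⁻¹) l))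
        (fun a a' => BG * (g.len a * (g.len a)⁻¹) * Real.exp (-(δ₀ * g.dist a a'))) := hDGpDk' k l
    have hX : HasMajorant (g := toB6 g Rr H) (fun p : S × ι => blk p.1) (conj b (diffLetter T U ((g.eta : ℂ)⁻¹) k) * gPrimeExtEnd Gp (conj b (vPrimeConc T U g.eta A blk kQ kF sQ sF cfun) * Gp))
        (fun a a' => B * g.len a * Real.exp (-(9 / 10 * δ₀ * g.dist a a'))) :=
      hL _ (fun a => g.len a) (fun a => (hlen a).le) (h342_2 k)
    have h := gExt_kernelEntry_of_386 (R := Rr) (H := H) (fun p : S × ι => blk p.1) d δ₀ (1 / 100) (1 / 100) (4 / 5 * δ₀) δ₀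
      (9 / 10 * δ₀) Λ BG B K (fun a => g.len a) (fun a => (g.len a)⁻¹) hBG.le hB hK (fun a => (hlen a).le)
      (fun a => inv_nonneg.mpr (hlen a).le) hΛ0 hρ0 hr' hrρ hdnn htri hT1i h261β hv hcK h365 h342 hX (k3' l)
    simpa only [hl10, mul_one] using h


end Final

end Literature.MathematicalPhysics.QuantumFieldTheory.Balaban1983to89.B9Thm34GpKernelFinal

end
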